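/-
Copyright (c) 2026 the pub-hodgecm-mathlib formalisation cell (harness21).  Prover seat hodgecm-mathlib-F0P2-p02 (g7), programme P2, N3 road (a),
brick (SJ-gen) «φ₀ SURJECTIVE» (K1∕N3 lead B-p18 (g29), LEAD WORDS 2026-08-31T23:56:16Z (3)).  KERNEL module: THEOREMS ONLY (no definition, no named
fact, no `sorry`, no instance, no notation).
-/
import Literature.NumberTheory.Automorphic.LocalSchwartzBruhatDirectSum
import HarnessLib

/-!
# The fibre-restriction functional `φ₀ : 𝒮(K^{α ⊕ β}) → 𝒮(K^β)`, `(φ₀ f)(u) = f(0, u)`, is SURJECTIVE (preimage `1_{𝒪^α} ⊠ g`)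

Topic `RepresentationTheory/HeisenbergGroup`; namespace `Literature.RepresentationTheory.HeisenbergGroup`.  KERNEL: theorems only.  Cell hodgecm-mathlib
FLOOR 0, programme P2, N3 road (a) of the K1∕N3 lead B-p18 (g29) — brick (SJ-gen), the separable, frame-independent half of «φ₀ surjective + the Jacquet
chart iso»: the Y-coinvariant chart of the local Schrödinger model of the mixed∕Weil representation is evaluation of the first block of coordinates at `0`
([GelbartRogawski1991, §3.2 p. 457: «the `N`-coinvariants of `ω³` are `Φ ↦ Φ(0) ∈ ℱ`»]; [Kudla1986, Thm. 2.8]; [MoeglinVignerasWaldspurger1987, Chap. 3 §IV.5]),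
and every Schwartz–Bruhat function `g` on the fibre `K^β` is attained: the product `1_{𝒪^α} ⊠ g ∈ 𝒮(K^{α ⊕ β})` (★ `boxSB`, [WeilBNT1967, Chap. VII §2
Prop. 2]) restricts to `1_{𝒪^α}(0) · g = g`.

* **`surjective_of_fibre_formula`** — any `ℂ`-linear `φ₀ : 𝒮(K^{α ⊕ β}) → 𝒮(K^β)` with `(φ₀ f)(u) = f (Sum.elim 0 u)` is surjective;
* `fibre_boxSB_indicator` — the computation `(1_{𝒪^α} ⊠ g)(Sum.elim 0 u) = g u` it rests on.

HONEST SCOPE.  Elementary; books nothing, discharges nothing booked.  HC_CM is proved only modulo the printed citations until rung 0 closes.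

## References
* [WeilBNT1967] A. Weil, *Basic Number Theory* (1967), Chap. VII §2, Def. 1, Prop. 2 (standard functions, products of Schwartz–Bruhat functions).
* [GelbartRogawski1991] S. Gelbart, J. Rogawski, Invent. Math. 105 (1991), §3.2 p. 457.
* [Kudla1986] S. Kudla, Invent. Math. 83 (1986), Thm. 2.8.  [MoeglinVignerasWaldspurger1987] LNM 1291, Chap. 3 §IV.5.
-/

set_option autoImplicit false

noncomputable section

namespace Literature.RepresentationTheory.HeisenbergGroup

open Literature.NumberTheory.Automorphic
open Literature.NumberTheory.GaloisRepresentations.IsNonarchimedeanLocalField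

variable (K : Type*) [Field K] [ValuativeRel K] [TopologicalSpace K] [IsNonarchimedeanLocalField K]
  {α β : Type*} [Fintype α] [Fintype β]

/-- **the fibre of a box product over `0`**: `(1_{𝒪^α} ⊠ g)(Sum.elim 0 u) = g u` (★ `coe_boxSB`; `resL id (Sum.elim 0 u) = 0`, `resR id (Sum.elim 0 u) = u`,
`1_{𝒪^α}(0) = 1`). [cite: WeilBNT1967, Chap. VII §2, Prop. 2] -/
theorem fibre_boxSB_indicator (g : SchwartzBruhat (β → K)) (u : β → K) :
    ((boxSB K (Equiv.refl (α ⊕ β))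
        (⟨(piPrimePowBall K α 0).indicator fun _ => (1 : ℂ), indicator_piPrimePowBall_mem_schwartzBruhat 0 1⟩ : SchwartzBruhat (α → K)) g :
          SchwartzBruhat ((α ⊕ β) → K)) : ((α ⊕ β) → K) → ℂ) (Sum.elim 0 u) =
      (g : (β → K) → ℂ) u := by
  rw [coe_boxSB]
  have hL : resL (Equiv.refl (α ⊕ β)) (Sum.elim (0 : α → K) u) = 0 := funext fun _ => rfl
  have hR : resR (Equiv.refl (α ⊕ β)) (Sum.elim (0 : α → K) u) = u := funext fun _ => rfl
  simp only [hL, hR, Set.indicator_of_mem (zero_mem_piPrimePowBall (F := K) (ι := α) 0), one_mul]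

/-- **`φ₀` IS SURJECTIVE**: a `ℂ`-linear map `φ₀ : 𝒮(K^{α ⊕ β}) → 𝒮(K^β)` given by restriction to the fibre over `0`, `(φ₀ f)(u) = f(0, u)`, attains every
`g ∈ 𝒮(K^β)` — at `f := 1_{𝒪^α} ⊠ g`.  (The Y-coinvariant chart of the local Schrödinger model is such a `φ₀`: [GelbartRogawski1991 §3.2 p. 457 «`r_N(ω³) ≅ ℱ`,
`Φ ↦ Φ(0)`»].) [cite: WeilBNT1967, Chap. VII §2, Prop. 2] [cite: GelbartRogawski1991, §3.2 p. 457] [cite: Kudla1986, Thm. 2.8] -/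
theorem surjective_of_fibre_formula (φ₀ : SchwartzBruhat ((α ⊕ β) → K) →ₗ[ℂ] SchwartzBruhat (β → K))
    (hφ₀ : ∀ (f : SchwartzBruhat ((α ⊕ β) → K)) (u : β → K),
      ((φ₀ f : SchwartzBruhat (β → K)) : (β → K) → ℂ) u = (f : ((α ⊕ β) → K) → ℂ) (Sum.elim 0 u)) :
    Function.Surjective φ₀ := by
  intro g
  refine ⟨boxSB K (Equiv.refl (α ⊕ β))
    (⟨(piPrimePowBall K α 0).indicator fun _ => (1 : ℂ), indicator_piPrimePowBall_mem_schwartzBruhat 0 1⟩ : SchwartzBruhat (α → K)) g, ?_⟩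
  refine Subtype.ext (funext fun u => ?_)
  rw [hφ₀, fibre_boxSB_indicator]

end Literature.RepresentationTheory.HeisenbergGroup

end
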